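import Literature.NumberTheory.Automorphic.UnboundedDenominators
import Literature.NumberTheory.Automorphic.WohlfahrtTheorem

/-!
# The unbounded denominators theorem (Calegari–Dimitrov–Tang) — the conclusion at the Wohlfahrt level: `Γ(N)` and `Γ₁(N)`

Tenth sibling of `Literature/NumberTheory/Automorphic/UnboundedDenominators.lean`. Sorry-free theorems
only; NO definition, NO named fact (D-0026). Sources: F. Calegari, V. Dimitrov, Y. Tang, *The
unbounded denominators conjecture*, J. Amer. Math. Soc. **38** (2025), Theorem 1.0.1 with §4.1
(Wohlfahrt level) and the last step of the proof of Lemma 4.4.1; K. Wohlfahrt, Illinois J. Math. 8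
(1964), Theorem 2 (tree: `Wohlfahrt.Gamma_le_of_isCongruenceSubgroup_of_forall_conj_T_pow_mem`).

The named fact `CalegariDimitrovTang2025_unboundedDenominators` concludes "`f` is a modular form on
SOME congruence subgroup". Consumers (e.g. the `c`-division road to Manin/Stevens constants in
`Summits/BirchSwinnertonDyer/…/ManinLocalTwoThree*`) always continue with Wohlfahrt's theorem: the
stabiliser of `f` is then a congruence subgroup all of whose cusp widths divide those of the
original level, hence contains `Γ(N)` — and `Γ₁(N) = Γ(N)⟨T⟩` when `T` is in the level. This file
records that upgrade once, fact-free in the stabiliser and with the fact as hypothesis: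

* `forall_mem_Gamma_slash_eq_of_exists_congruence` — if `f ∈ M_k(Γ)`, every conjugate `g Tᴺ g⁻¹`
  lies in `Γ` (Wohlfahrt level of `Γ` divides `N`) and `f` agrees with a modular form on a
  congruence subgroup, then `f ∣ₖ γ = f` for all `γ ∈ Γ(N)` (no fact needed).
* `forall_mem_Gamma1_slash_eq_of_forall_mem_Gamma` — if moreover `T ∈ Γ`, then `f ∣ₖ γ = f` for
  all `γ ∈ Γ₁(N)` (`Γ₁(N) = Γ(N)·⟨T⟩`).
* `CalegariDimitrovTang2025_unboundedDenominators.forall_mem_Gamma_slash_eq`,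
  `….forall_mem_Gamma1_slash_eq`, `….exists_modularForm_Gamma` — **the unbounded denominators
  theorem at the Wohlfahrt level**: granting the fact, an integral-`q`-expansion form on a
  finite-index `Γ` containing all conjugates of `Tᴺ` is `Γ(N)`-invariant, `Γ₁(N)`-invariant if
  `T ∈ Γ`, and is a modular form on `Γ(N)`.
-/

noncomputable section

namespace Literature.NumberTheory.Automorphic

open scoped MatrixGroups ModularForm
open CongruenceSubgroup Matrix.SpecialLinearGroup ModularGroup UpperHalfPlane

variable {Γ : Subgroup SL(2, ℤ)} {N : ℕ} {k : ℤ}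

/-- The stabiliser of a function under the weight-`k` slash action, as a subgroup of `SL(2, ℤ)`
(private plumbing). [folklore] -/
private lemma exists_stabilizer (φ : ℍ → ℂ) (k : ℤ) :
    ∃ S : Subgroup SL(2, ℤ), ∀ x : SL(2, ℤ), x ∈ S ↔ φ ∣[k] (mapGL ℝ x) = φ := by
  refine ⟨{ carrier := {x | φ ∣[k] (mapGL ℝ x) = φ}
            mul_mem' := fun {a b} ha hb ↦ by
              simp only [Set.mem_setOf_eq] at ha hb ⊢
              rw [map_mul, SlashAction.slash_mul, ha, hb]
            one_mem' := by simp only [Set.mem_setOf_eq, map_one, SlashAction.slash_one]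
            inv_mem' := fun {a} ha ↦ by
              simp only [Set.mem_setOf_eq] at ha ⊢
              calc φ ∣[k] (mapGL ℝ a⁻¹) = (φ ∣[k] (mapGL ℝ a)) ∣[k] (mapGL ℝ a⁻¹) := by rw [ha]
                _ = φ := by
                  rw [← SlashAction.slash_mul, ← map_mul, mul_inv_cancel, map_one,
                    SlashAction.slash_one] }, fun x ↦ Iff.rfl⟩

/-- **Congruence forms of Wohlfahrt level dividing `N` are `Γ(N)`-invariant** (Wohlfahrt's theorem
applied to the stabiliser; the last step of [cite: CalegariDimitrovTang2025, Lemma 4.4.1 (proof)]: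
"the smallest congruence subgroup of Wohlfahrt level `N` containing `E` is precisely `⟨E, Γ(N)⟩`").
Let `f` be a weight-`k` modular form on `Γ ≤ SL(2, ℤ)` with every conjugate `g Tᴺ g⁻¹` in `Γ`, and
suppose `f` is (the function of) a modular form on some congruence subgroup. Then `f ∣ₖ γ = f` for
every `γ ∈ Γ(N)`. -/
theorem forall_mem_Gamma_slash_eq_of_exists_congruence (hT : ∀ g : SL(2, ℤ), g * T ^ N * g⁻¹ ∈ Γ)
    (f : ModularForm (Γ : Subgroup (GL (Fin 2) ℝ)) k)
    (hf : ∃ (Γ' : Subgroup SL(2, ℤ)) (g : ModularForm (Γ' : Subgroup (GL (Fin 2) ℝ)) k),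
      IsCongruenceSubgroup Γ' ∧ (g : ℍ → ℂ) = f) :
    ∀ γ ∈ Gamma N, (⇑f : ℍ → ℂ) ∣[k] (mapGL ℝ γ) = ⇑f := by
  obtain ⟨Γ', g, hΓ', hgf⟩ := hf
  obtain ⟨S, hS⟩ := exists_stabilizer (⇑f : ℍ → ℂ) k
  have hΓS : Γ ≤ S := fun x hx ↦
    (hS x).mpr (SlashInvariantForm.slash_action_eqn f _ (Subgroup.mem_map_of_mem _ hx))
  have hΓ'S : Γ' ≤ S := fun x hx ↦ (hS x).mpr (by
    simpa only [hgf] using SlashInvariantForm.slash_action_eqn g _ (Subgroup.mem_map_of_mem _ hx))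
  have hcong : IsCongruenceSubgroup S := isCongruenceSubgroup_trans _ _ hΓ'S hΓ'
  have hle : Gamma N ≤ S :=
    Wohlfahrt.Gamma_le_of_isCongruenceSubgroup_of_forall_conj_T_pow_mem hcong fun x ↦ hΓS (hT x)
  exact fun γ hγ ↦ (hS γ).mp (hle hγ)

/-- **`Γ₁(N) = Γ(N)·⟨T⟩`**: a function that is slash-invariant under `Γ(N)` and under `T` is
invariant under `Γ₁(N)` (for `γ ∈ Γ₁(N)`, `γ T^{-b} ∈ Γ(N)` with `b = γ₀₁`). This is the step
"Wohlfahrt + `T` ⟹ `Γ₁(N)`" of the `c`-division road to the Manin constant.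
[cite: CalegariDimitrovTang2025, §4.1] -/
theorem forall_mem_Gamma1_slash_eq_of_forall_mem_Gamma {φ : ℍ → ℂ}
    (hN : ∀ γ ∈ Gamma N, φ ∣[k] (mapGL ℝ γ) = φ) (hT : φ ∣[k] (mapGL ℝ T) = φ) :
    ∀ γ ∈ Gamma1 N, φ ∣[k] (mapGL ℝ γ) = φ := by
  obtain ⟨S, hS⟩ := exists_stabilizer φ k
  have hTS : T ∈ S := (hS T).mpr hT
  intro γ hγ
  obtain ⟨h00, h11, h10⟩ := (Gamma1_mem N γ).mp hγ
  -- `γ T^{-b} ∈ Γ(N)` for `b = γ 0 1`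
  have hmem : γ * T ^ (-(γ 0 1 : ℤ)) ∈ Gamma N := by
    rw [Gamma_mem, coe_mul, coe_T_zpow]
    simp only [Matrix.mul_apply, Fin.sum_univ_two, Matrix.of_apply, Matrix.cons_val',
      Matrix.cons_val_zero, Matrix.cons_val_one, Matrix.cons_val_fin_one, Matrix.empty_val']
    push_cast
    rw [h00, h10, h11]
    refine ⟨by ring, by ring, by ring, by ring⟩
  have hγS : γ ∈ S := by
    have := mul_mem ((hS _).mpr (hN _ hmem)) (Subgroup.zpow_mem S hTS (γ 0 1 : ℤ))
    rwa [mul_assoc, ← zpow_add, neg_add_cancel, zpow_zero, mul_one] at this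
  exact (hS γ).mp hγS

/-- **The unbounded denominators theorem at the Wohlfahrt level** [cite: CalegariDimitrovTang2025,
Theorem 1.0.1 with §4.1]: granting the fact, a weight-`k` modular form on a finite-index
`Γ ≤ SL(2, ℤ)` containing every conjugate of `Tᴺ` (`N ≥ 1`; so all cusp widths divide `N` and `N`
is a strict period) whose `q`-expansion in `e^{2πiτ/N}` has rational-integer coefficients satisfies
`f ∣ₖ γ = f` for every `γ ∈ Γ(N)`. -/
theorem CalegariDimitrovTang2025_unboundedDenominators.forall_mem_Gamma_slash_eq
    (hCDT : CalegariDimitrovTang2025_unboundedDenominators) [Γ.FiniteIndex] (hN : 0 < N)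
    (hT : ∀ g : SL(2, ℤ), g * T ^ N * g⁻¹ ∈ Γ) (f : ModularForm (Γ : Subgroup (GL (Fin 2) ℝ)) k)
    (hint : ∀ n : ℕ, ∃ z : ℤ, PowerSeries.coeff n (qExpansion (N : ℝ) f) = (z : ℂ)) :
    ∀ γ ∈ Gamma N, (⇑f : ℍ → ℂ) ∣[k] (mapGL ℝ γ) = ⇑f := by
  have hTN : T ^ N ∈ Γ := by simpa using hT 1
  exact forall_mem_Gamma_slash_eq_of_exists_congruence hT f
    (hCDT Γ k f N hN (Wohlfahrt.natCast_mem_strictPeriods_iff_T_pow_mem.mpr hTN) hint)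

/-- **… and `Γ₁(N)`-invariance when `T ∈ Γ`** [cite: CalegariDimitrovTang2025, Theorem 1.0.1
with §4.1]: under the same hypotheses plus `T ∈ Γ` (cusp width `1` at `∞`; the integrality
hypothesis may then be taken at any positive period, here `N`), `f ∣ₖ γ = f` for every
`γ ∈ Γ₁(N)`. This is the form in which the theorem enters the `c`-division road to the Manin and
Stevens constants ("Stab is congruence ⟹ Wohlfahrt ⟹ `Γ₁(N) ⊆ Stab`"). -/
theorem CalegariDimitrovTang2025_unboundedDenominators.forall_mem_Gamma1_slash_eq
    (hCDT : CalegariDimitrovTang2025_unboundedDenominators) [Γ.FiniteIndex] (hN : 0 < N)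
    (hT : ∀ g : SL(2, ℤ), g * T ^ N * g⁻¹ ∈ Γ) (hT1 : T ∈ Γ)
    (f : ModularForm (Γ : Subgroup (GL (Fin 2) ℝ)) k)
    (hint : ∀ n : ℕ, ∃ z : ℤ, PowerSeries.coeff n (qExpansion (N : ℝ) f) = (z : ℂ)) :
    ∀ γ ∈ Gamma1 N, (⇑f : ℍ → ℂ) ∣[k] (mapGL ℝ γ) = ⇑f :=
  forall_mem_Gamma1_slash_eq_of_forall_mem_Gamma
    (CalegariDimitrovTang2025_unboundedDenominators.forall_mem_Gamma_slash_eq hCDT hN hT f hint)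
    (SlashInvariantForm.slash_action_eqn f _ (Subgroup.mem_map_of_mem _ hT1))

/-- **… bundled: `f` is a modular form on `Γ(N)`** [cite: CalegariDimitrovTang2025, Theorem 1.0.1
with §4.1] (holomorphy is that of `f`; the cusps of `Γ(N)` and of `Γ` are those of `SL(2, ℤ)`). -/
theorem CalegariDimitrovTang2025_unboundedDenominators.exists_modularForm_Gamma
    (hCDT : CalegariDimitrovTang2025_unboundedDenominators) [Γ.FiniteIndex] (hN : 0 < N)
    (hT : ∀ g : SL(2, ℤ), g * T ^ N * g⁻¹ ∈ Γ) (f : ModularForm (Γ : Subgroup (GL (Fin 2) ℝ)) k)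
    (hint : ∀ n : ℕ, ∃ z : ℤ, PowerSeries.coeff n (qExpansion (N : ℝ) f) = (z : ℂ)) :
    ∃ g : ModularForm ((Gamma N : Subgroup SL(2, ℤ)) : Subgroup (GL (Fin 2) ℝ)) k,
      (g : ℍ → ℂ) = f := by
  haveI : NeZero N := ⟨hN.ne'⟩
  have hinv := CalegariDimitrovTang2025_unboundedDenominators.forall_mem_Gamma_slash_eq hCDT hN hT
    f hint
  exact ⟨{ toFun := f
           slash_action_eq' := by
             rintro _ ⟨γ, hγ, rfl⟩
             exact hinv γ hγ
           holo' := f.holo'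
           bdd_at_cusps' := fun hc ↦ f.bdd_at_cusps'
             ((Subgroup.IsArithmetic.isCusp_iff_isCusp_SL2Z _).mpr
               ((Subgroup.IsArithmetic.isCusp_iff_isCusp_SL2Z _).mp hc)) }, rfl⟩

end Literature.NumberTheory.Automorphic

end
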